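import Summits.Langlands.Langlands.Theorems.IrreducibilityBySelfDualityReciprocityUpToIrreducibilityArtinLocalGlobal
import Literature.NumberTheory.GaloisRepresentations.LocalArtinMapUnique
import Literature.NumberTheory.GaloisRepresentations.LocalArtinMapPinned
import HarnessLib

/-!
# Line `Sketch` for the crux `ReciprocityUpToIrreducibility` (item stmt-Langlands-14328), continuation c8:
# wave N8 — the Artin pin's T0 debts are discharged; c7's rank-one sector for every CANONICAL `Rec`

Support file (closes nothing; `--supports stmt-Langlands-14328`; registered stubs of the checked skeleton
`Lines/Sketch.lean` §1n: `stub_isLocalArtinMap_unique` (S1), `stub_exists_isLocalArtinMap` (S2),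
`stub_glOne_reciprocity_of_isCanonical` (lead glue)).

c7 (`…ReciprocityUpToIrreducibilityArtinLocalGlobal.lean`, p134123) proved both directions of the summit in
rank one on the finite-order / open-kernel sector unramified above `ℓ` for every reciprocity datum `Rec` whose
local Artin maps satisfy the five characterising clauses `IsLocalArtinMap` of the pin
(`Literature/NumberTheory/GaloisRepresentations/LocalClassFieldTheory.lean`), modulo `FontaineDatumExists` and
the class-field-theory fact `artinCharacter_localGlobalCompatible` (Neukirch VI (5.6)).  The summit's announced
field `ReciprocityData.llc_isCanonical` says instead `(Rec.llc v).artin.IsCanonical`, i.e.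
`(Rec.llc v).artin.artin = canonicalArtin (K_v) = ε(IsLocalArtinMap (K_v))`, which gives the clauses only under
the pin's two named facts — BOTH NOW THEOREMS of the tree (wave N8 of this lead, proved by the two stub
workers): `IsLocalArtinMap.unique_holds` (`LocalArtinMapUnique.lean`, p136353: Lubin–Tate norm groups +
the finite-level reciprocity law pin the value on every element of degree `-1`, and those generate `W_F`) and
`exists_isLocalArtinMap_holds` (`LocalArtinMapPinned.lean`, p136311: clause (b) for the tree's own theta-based
Artin map is the reciprocity system's `ker_eq`).  Hence (this file): a local Artin datum is canonical IFF its
map has the five clauses (`isCanonical_iff_isLocalArtinMap`), and c7's sector theorems hold for every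
canonically normalised `Rec` modulo {`FontaineDatumExists`, `artinCharacter_localGlobalCompatible`} only
(`automorphicToGalois_glOne_of_isCanonical`, `galoisToAutomorphic_glOne_of_isCanonical`,
`stub_glOne_reciprocity_of_isCanonical`).  No definitions; std axioms.
-/

noncomputable section

set_option linter.dupNamespace false -- project-wide option (lakefile weak.linter.dupNamespace); `Summit.Langlands.Langlands` is the mandated namespace

open scoped MatrixGroups Matrix NumberField Classical Polynomial
open Filter IsDedekindDomain Field Polynomial
open Literature.NumberTheory.Automorphic Literature.NumberTheory.GaloisRepresentations
open Literature.NumberTheory.PAdicHodge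
open Summit.Langlands

namespace Summit.Langlands.Langlands.Theorems.ReciprocityUpToIrreducibility

/-! ## 1. The two debts of the pin (registered stubs S1, S2) -/

/-- **Stub S1 (wave N8): uniqueness of the local Artin map** — two homomorphisms `W_F →* Fˣ` with the five
characterising clauses coincide (the named fact `IsLocalArtinMap.unique F`, Milne I Thm. 1.1; Serre XIII §4
Thm. 1–2), by the Literature theorem `IsLocalArtinMap.unique_holds` (worker A of wave N8).
[cite: SerreLocalFields1979, Ch. XIII §4 Thm. 1–2] -/
theorem stub_isLocalArtinMap_unique :
    ∀ (F : Type) [Field F] [ValuativeRel F] [TopologicalSpace F] [IsNonarchimedeanLocalField F],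
      IsLocalArtinMap.unique F :=
  fun F _ _ _ _ => IsLocalArtinMap.unique_holds F

/-- **Stub S2 (wave N8): existence of a local Artin map with the five clauses** (the named fact
`exists_isLocalArtinMap F`, Milne I Thm. 1.1 existence with the finite-level reciprocity law), by the
Literature theorem `exists_isLocalArtinMap_holds` (worker B of wave N8: the tree's own theta-based Artin map).
[cite: SerreLocalFields1979, Ch. XIII §4 Thm. 2] [cite: Corvallis1979, (1.4.1)] -/
theorem stub_exists_isLocalArtinMap :
    ∀ (F : Type) [Field F] [ValuativeRel F] [TopologicalSpace F] [IsNonarchimedeanLocalField F],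
      exists_isLocalArtinMap F :=
  fun F _ _ _ _ => exists_isLocalArtinMap_holds F

/-! ## 2. Canonical = has the five clauses -/

section Canonical

variable {F : Type} [Field F] [ValuativeRel F] [TopologicalSpace F] [IsNonarchimedeanLocalField F]

/-- **A canonically normalised local Artin datum satisfies all five clauses** (`d.artin = canonicalArtin F`
and `isLocalArtinMap_canonicalArtin_holds`). [cite: SerreLocalFields1979, Ch. XIII §4 Thm. 1–2] -/
theorem isLocalArtinMap_of_isCanonical {d : LocalArtinData F} (hd : d.IsCanonical) :
    IsLocalArtinMap F d.artin := by
  rw [hd]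
  exact isLocalArtinMap_canonicalArtin_holds F

/-- **A local Artin datum is canonical iff its map has the five clauses** (`⇐` is uniqueness,
`LocalArtinData.isCanonical_of_unique` with `IsLocalArtinMap.unique_holds`). [cite: SerreLocalFields1979, Ch. XIII §4 Thm. 1–2] -/
theorem isCanonical_iff_isLocalArtinMap (d : LocalArtinData F) :
    d.IsCanonical ↔ IsLocalArtinMap F d.artin :=
  ⟨isLocalArtinMap_of_isCanonical, LocalArtinData.isCanonical_of_unique (IsLocalArtinMap.unique_holds F)⟩

/-- In particular the four-clause datum packaged from existence, `LocalArtinData.ofExistsIsLocalArtinMap`, and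
every datum with the clauses have the SAME Artin map: `d.artin = canonicalArtin F`. [folklore] -/
theorem artin_eq_canonicalArtin_of_isLocalArtinMap {d : LocalArtinData F} (hd : IsLocalArtinMap F d.artin) :
    d.artin = canonicalArtin F :=
  (isCanonical_iff_isLocalArtinMap d).mpr hd

end Canonical

/-! ## 3. c7's rank-one sector for every canonically normalised `Rec` -/

section RankOne

variable {K : Type} [Field K] [NumberField K] {ℓ : ℕ} [Fact ℓ.Prime]

/-- **(A) in rank one at `π_θ` (`θ` finite order, unramified above `ℓ`) for every CANONICAL `Rec`**, modulo
`FontaineDatumExists` and `artinCharacter_localGlobalCompatible` only (c7's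
`automorphicToGalois_glOne_of_isLocalArtinMap` with the hypothesis discharged by `isLocalArtinMap_of_isCanonical`).
[cite: BuzzardGeeLMS2014, Conj. 3.2.1–3.2.2 (n = 1)] [cite: NeukirchANT1999, Ch. VI Prop. (5.6)] -/
theorem automorphicToGalois_glOne_of_isCanonical (hF : FontaineDatumExists)
    (hLG : artinCharacter_localGlobalCompatible) {hcpt : isCompact_glFiniteIntegralLevel 1 K}
    (Rec : ReciprocityData K) (hRec : ∀ v : HeightOneSpectrum (𝓞 K), (Rec.llc v).artin.IsCanonical)
    (ι : PadicAlgCl ℓ ≃+* ℂ) {π : AutomorphicRepData (AutomorphyDatum.gl 1 K hcpt)} {θ : HeckeCharacter K}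
    (hW : π.W = Submodule.span ℂ {fun g : (AdelicGroupData.gl 1 K).Adelic => (detTwist 1 θ g : ℂ)})
    (hW' : π.W' = ⊥) (hfin : θ.IsFiniteOrder)
    (hθℓ : ∀ v : HeightOneSpectrum (𝓞 K), ((ℓ : ℕ) : 𝓞 K) ∈ v.asIdeal → θ.IsUnramifiedAt v) :
    ∃ ρ : FramedGaloisRep K (PadicAlgCl ℓ) 1,
      ρ.toGaloisRep.IsIrreducible ∧ IsGeometricFramed Rec ρ ∧ Corresponds Rec ι π ρ ∧
        ∀ ρ' : FramedGaloisRep K (PadicAlgCl ℓ) 1, Corresponds Rec ι π ρ' → IsConjugate ρ ρ' :=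
  automorphicToGalois_glOne_of_isLocalArtinMap hF hLG Rec (fun v => isLocalArtinMap_of_isCanonical (hRec v)) ι
    hW hW' hfin hθℓ

/-- **(B) in rank one at an open-kernel `ρ` unramified a.e. and above `ℓ`, for every CANONICAL `Rec`**, modulo
`FontaineDatumExists` and `artinCharacter_localGlobalCompatible` only (c7's
`galoisToAutomorphic_glOne_of_isLocalArtinMap`). [cite: FontaineMazurGeometric1995, Conj. 1 (n = 1)]
[cite: NeukirchANT1999, Ch. VI Prop. (5.6)] -/
theorem galoisToAutomorphic_glOne_of_isCanonical (hF : FontaineDatumExists)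
    (hLG : artinCharacter_localGlobalCompatible) (hcpt : isCompact_glFiniteIntegralLevel 1 K)
    (Rec : ReciprocityData K) (hRec : ∀ v : HeightOneSpectrum (𝓞 K), (Rec.llc v).artin.IsCanonical)
    (ι : PadicAlgCl ℓ ≃+* ℂ) (ρ : FramedGaloisRep K (PadicAlgCl ℓ) 1)
    (hker : IsOpen (ρ.toMonoidHom.ker : Set (absoluteGaloisGroup K)))
    (hae : ∀ᶠ v : HeightOneSpectrum (𝓞 K) in cofinite, ρ.IsUnramifiedAt v)
    (hρℓ : ∀ v : HeightOneSpectrum (𝓞 K), ((ℓ : ℕ) : 𝓞 K) ∈ v.asIdeal → ρ.IsUnramifiedAt v) :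
    ∃ π : CuspidalAutomorphicRepData 1 K hcpt, π.1.IsLAlgebraic ∧ Corresponds Rec ι π.1 ρ :=
  galoisToAutomorphic_glOne_of_isLocalArtinMap hF hLG hcpt Rec (fun v => isLocalArtinMap_of_isCanonical (hRec v))
    ι ρ hker hae hρℓ

end RankOne

/-- **Registered stub (c8 lead glue): both directions of the summit in rank one on the finite-order /
open-kernel sector unramified above `ℓ`, for EVERY canonically normalised reciprocity datum**, modulo
`FontaineDatumExists` and the one class-field-theory fact `artinCharacter_localGlobalCompatible`
(Neukirch VI (5.6)); the pin's own debts are discharged (stubs S1, S2 above).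
[cite: BuzzardGeeLMS2014, Conj. 3.2.1–3.2.2 (n = 1)] [cite: NeukirchANT1999, Ch. VI Prop. (5.6)]
[cite: FontaineMazurGeometric1995, Conj. 1 (n = 1)] -/
theorem stub_glOne_reciprocity_of_isCanonical (hF : FontaineDatumExists)
    (hLG : artinCharacter_localGlobalCompatible) {K : Type} [Field K] [NumberField K] {ℓ : ℕ}
    [Fact ℓ.Prime] (hcpt : isCompact_glFiniteIntegralLevel 1 K) (Rec : ReciprocityData K)
    (hRec : ∀ v : HeightOneSpectrum (𝓞 K), (Rec.llc v).artin.IsCanonical)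
    (ι : PadicAlgCl ℓ ≃+* ℂ) :
    (∀ (π : AutomorphicRepData (AutomorphyDatum.gl 1 K hcpt)) (θ : HeckeCharacter K),
      π.W = Submodule.span ℂ {fun g : (AdelicGroupData.gl 1 K).Adelic => (detTwist 1 θ g : ℂ)} →
      π.W' = ⊥ → θ.IsFiniteOrder →
      (∀ v : HeightOneSpectrum (𝓞 K), ((ℓ : ℕ) : 𝓞 K) ∈ v.asIdeal → θ.IsUnramifiedAt v) →
      ∃ ρ : FramedGaloisRep K (PadicAlgCl ℓ) 1,
        ρ.toGaloisRep.IsIrreducible ∧ IsGeometricFramed Rec ρ ∧ Corresponds Rec ι π ρ ∧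
          ∀ ρ' : FramedGaloisRep K (PadicAlgCl ℓ) 1, Corresponds Rec ι π ρ' → IsConjugate ρ ρ') ∧
    (∀ ρ : FramedGaloisRep K (PadicAlgCl ℓ) 1,
      IsOpen (ρ.toMonoidHom.ker : Set (Field.absoluteGaloisGroup K)) →
      (∀ᶠ v : HeightOneSpectrum (𝓞 K) in cofinite, ρ.IsUnramifiedAt v) →
      (∀ v : HeightOneSpectrum (𝓞 K), ((ℓ : ℕ) : 𝓞 K) ∈ v.asIdeal → ρ.IsUnramifiedAt v) →
      ∃ π : CuspidalAutomorphicRepData 1 K hcpt, π.1.IsLAlgebraic ∧ Corresponds Rec ι π.1 ρ) :=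
  ⟨fun _ _ hW hW' hfin hθℓ => automorphicToGalois_glOne_of_isCanonical hF hLG Rec hRec ι hW hW' hfin hθℓ,
    fun ρ hker hae hρℓ => galoisToAutomorphic_glOne_of_isCanonical hF hLG hcpt Rec hRec ι ρ hker hae hρℓ⟩

end Summit.Langlands.Langlands.Theorems.ReciprocityUpToIrreducibility

end
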